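import Literature.AlgebraicGeometry.Resolution.StalkHeightIsoLocus
import Mathlib.AlgebraicGeometry.Restrict
import HarnessLib

/-!
# Heights of contracted primes of a stalk not containing a function inverted off the centre

Topic: `Literature/AlgebraicGeometry/Resolution`. PROOF side of `CossartPiltant2019ReductionP`
(`ArithmeticalThreefoldsLocal.lean`), input (C4), [CoP1] Prop. 8.1 (1) (V. Cossart,
O. Piltant, HAL hal-00139124, p. 22: "`(S₁)_f = (S₂)_f`"). For a morphism `f : X ⟶ Y` which
restricts to an isomorphism over the basic open `Y_r` of a global function `r`, a point `x ∈ X`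
and a prime `𝔓 ⊂ 𝒪_{X,x}` NOT containing the germ of `f^* r`, the contraction of `𝔓` to
`𝒪_{Y,f x}` has the same height as `𝔓`: the generization `x′ ⤳ x` with centre `𝔓`
(Stacks 01J7) lies in `X_{f^* r} = f⁻¹(Y_r)`, where the stalk map is an isomorphism, and
`height_comap_stalkMap_eq_of_isIso_stalkMap` applies. This is the stalk-level form of the
remark that the local uniformizations produced by an embedded resolution of `V(r)` — an
isomorphism off `V(r)` — have their prime divisors not containing `r` lying over height-one
primes (`DenominatorsFromExceptionalLocus.lean`, hypothesis EXC).

Everything is PROVED; no named facts, definitions, instances or notation are introduced.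

## Sources

* V. Cossart, O. Piltant, J. Algebra 320 (2008) 1051–1082: Prop. 8.1 (1) (HAL p. 22). [CossartPiltant2008]
* The Stacks Project, Tag 01J7. [StacksProject]
-/

noncomputable section

open CategoryTheory AlgebraicGeometry TopologicalSpace IsLocalRing

namespace Literature.AlgebraicGeometry.Resolution

universe u

/-- **Contracted heights off the exceptional locus.** Let `f : X ⟶ Y` restrict to an
isomorphism over the basic open `Y_r` of `r ∈ Γ(Y, 𝒪_Y)`, let `x ∈ X` and let `𝔓 ⊂ 𝒪_{X,x}` be
a prime not containing the germ of `f^* r`. Then the contraction of `𝔓` along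
`𝒪_{Y,f x} → 𝒪_{X,x}` has the same height as `𝔓`. [cite: StacksProject, Tag 01J7]
[cite: CossartPiltant2008, Prop. 8.1 (1) (HAL p. 22)] -/
theorem height_comap_stalkMap_eq_of_isIso_restrict_basicOpen {X Y : Scheme.{u}} (f : X ⟶ Y)
    (r : Γ(Y, ⊤)) [IsIso (f ∣_ Y.basicOpen r)] (x : X) (𝔓 : Ideal (X.presheaf.stalk x))
    [𝔓.IsPrime] (hr : X.presheaf.germ ⊤ x trivial (f.app ⊤ r) ∉ 𝔓) :
    (𝔓.comap (f.stalkMap x).hom).height = 𝔓.height := by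
  -- the generization `x'` of `x` with centre `𝔓`
  obtain ⟨x', hx', h𝔓⟩ := exists_specializes_comap_stalkSpecializes_eq x 𝔓
  -- `x'` lies in `X_{f^* r} = f ⁻¹ (Y_r)`
  have hgerm : X.presheaf.germ ⊤ x' trivial (f.app ⊤ r) ∉ maximalIdeal (X.presheaf.stalk x') := by
    intro hmem
    apply hr
    rw [h𝔓, Ideal.mem_comap]
    have h1 : (X.presheaf.stalkSpecializes hx').hom (X.presheaf.germ ⊤ x trivial (f.app ⊤ r)) =
        X.presheaf.germ ⊤ x' trivial (f.app ⊤ r) := by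
      rw [← CategoryTheory.comp_apply, TopCat.Presheaf.germ_stalkSpecializes]
    rw [h1]
    exact hmem
  have hunit : IsUnit (X.presheaf.germ ⊤ x' trivial (f.app ⊤ r)) := by
    by_contra h
    exact hgerm ((IsLocalRing.mem_maximalIdeal _).mpr h)
  have hx'U : f x' ∈ Y.basicOpen r := by
    have h1 : x' ∈ X.basicOpen (f.app ⊤ r) := (X.mem_basicOpen (f.app ⊤ r) x' trivial).mpr hunit
    rw [← Scheme.preimage_basicOpen] at h1
    exact h1
  -- hence the stalk map at `x'` is an isomorphism
  have hiso : IsIso (f.stalkMap x') := by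
    let x₀ : ↑(f ⁻¹ᵁ Y.basicOpen r) := ⟨x', hx'U⟩
    have h1 : IsIso ((f ∣_ Y.basicOpen r).stalkMap x₀) := inferInstance
    have e := morphismRestrictStalkMap f (Y.basicOpen r) x₀
    exact (Arrow.isIso_iff_isIso_of_isIso e.hom).mp h1 |> fun h => by simpa using h
  rw [h𝔓]
  exact height_comap_stalkMap_eq_of_isIso_stalkMap f hx' hiso

end Literature.AlgebraicGeometry.Resolution

end
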